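import Summits.CriticalPhenomena.PercolationContinuityZ3.Theorems.PercNearOneGluingNoHeavyLowerTailFreeEdgeStep
import Summits.CriticalPhenomena.PercolationContinuityZ3.Theorems.PercNearOneGluingNoHeavyLowerTailFreePeel
import Summits.CriticalPhenomena.PercolationContinuityZ3.Theorems.PercNearOneGluingNoHeavyLowerTailConjSTarget
import HarnessLib

/-!
# `NoHeavyLowerTail` (stmt-CriticalPhenomena-4575) — the typed targets with the ranking EXISTENTIALLY quantified (tie-break freedom)

Support file (prover `prim-hp-8`, PL programme; `--supports stmt-CriticalPhenomena-4575`).  No definitions, no named facts, no sorries.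

The typed targets `CoinReduction.noHeavyLowerTail_of_conjS`, `…_of_freePeel`, `…_of_glueStep_of_glued` ask their hypothesis for EVERY
injective `H`-compatible ranking `r`.  On the total-tie locus of `S^H` (e.g. all relays surely light in `H`) every ranking is `H`-compatible, and
the ttrl2 census (cp-hp8, pl/conjS/GLUESTEP.md, 2026-08-19) found instances where the glue-step `(B*)` FAILS for SOME tie-break while it holds
for others (12 / 2.15·10⁸ observer multigraphs; 0 when one may choose the tie-break; 0 with the `G`-order).  The reductions never needed the
hypothesis for all rankings: ONE ranking per `(H, A, o, j)` that is injective on `A` (and, for the peeling/glue-step forms, `H`-compatible, which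
`coinStep` uses) and for which the local inequality holds along all weight functions agreeing with the given one off the pairs at `o` suffices.
This file states the three targets in that form:

* `noHeavyLowerTail_of_cornerPairs_exists` — ∃ an injective ranking with corner-pair positivity (Conjecture S for that ranking) ⇒ crux
  (no compatibility needed at all: `patternLightest_stub_of_cornerPairs` works for any fixed ranking);
* `noHeavyLowerTail_of_freePeel_exists` — ∃ an injective `H`-compatible ranking with free-edge peeling (FP) ⇒ crux;
* `noHeavyLowerTail_of_glueStep_exists` — ∃ an injective `H`-compatible ranking with the glue-step `(B*)` and positivity for deterministic
  observers ⇒ crux.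
-/

noncomputable section

namespace Summit.CriticalPhenomena.PercolationContinuityZ3.Theorems

namespace CoinReduction

open MeasureTheory Set Literature.Probability.LatticeModels Literature.Probability.Percolation
open scoped Classical BigOperators

/-- **Typed target (tie-break form): corner-pair positivity for SOME injective ranking ⇒ `NoHeavyLowerTail`.**  If for every weighted graph,
relay set `A`, observer `o ∉ A` and level `j` there is a ranking `r`, injective on `A`, such that `B(v₁,v₂) + B(v₂,v₁) ≥ 0` for all pairs of
deterministic observers `v₁, v₂` agreeing with `w` off the pairs at `o` (`B` as in `…ConjSTarget`), then the crux holds.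
[folklore — reduction only; `patternLightest_stub_of_cornerPairs`] -/
theorem noHeavyLowerTail_of_cornerPairs_exists
    (h : ∀ (n : ℕ) (w : Sym2 (Fin n) → unitInterval) (A : Finset (Fin n)) (o : Fin n) (j : ℕ), o ∉ A →
      ∃ r : Fin n → ℕ, Set.InjOn r ↑A ∧
        ∀ v₁ v₂ : Sym2 (Fin n) → unitInterval,
          (∀ e : Sym2 (Fin n), o ∉ e → v₁ e = w e ∧ v₂ e = w e) →
          (∀ y : Fin n, y ≠ o → (v₁ s(o, y) = 0 ∨ v₁ s(o, y) = 1) ∧ (v₂ s(o, y) = 0 ∨ v₂ s(o, y) = 1)) →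
          0 ≤ (∑ b ∈ A, (Literature.Probability.LatticeModels.prodBernoulli v₁).real
                  {ω : Literature.Probability.Percolation.BondConfig (Fin n) |
                    b ∈ (A.filter fun b' => ω ∈ Literature.Probability.Percolation.openConnIn ((↑A : Set (Fin n))ᶜ ∪ {b'}) o b') ∧
                    ∀ b' ∈ A, r b' < r b →
                      b' ∉ (A.filter fun b'' => ω ∈ Literature.Probability.Percolation.openConnIn ((↑A : Set (Fin n))ᶜ ∪ {b''}) o b'')} *
                (Literature.Probability.LatticeModels.prodBernoulli v₂).real
                  {ω : Literature.Probability.Percolation.BondConfig (Fin n) |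
                    (A.filter fun z => ω ∈ Literature.Probability.Percolation.openConn b z).card ≤ j} -
              (Literature.Probability.LatticeModels.prodBernoulli v₁).real
                {ω : Literature.Probability.Percolation.BondConfig (Fin n) |
                  1 ≤ (A.filter fun z => ω ∈ Literature.Probability.Percolation.openConn o z).card ∧
                  (A.filter fun z => ω ∈ Literature.Probability.Percolation.openConn o z).card ≤ j}) +
            (∑ b ∈ A, (Literature.Probability.LatticeModels.prodBernoulli v₂).real
                  {ω : Literature.Probability.Percolation.BondConfig (Fin n) |
                    b ∈ (A.filter fun b' => ω ∈ Literature.Probability.Percolation.openConnIn ((↑A : Set (Fin n))ᶜ ∪ {b'}) o b') ∧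
                    ∀ b' ∈ A, r b' < r b →
                      b' ∉ (A.filter fun b'' => ω ∈ Literature.Probability.Percolation.openConnIn ((↑A : Set (Fin n))ᶜ ∪ {b''}) o b'')} *
                (Literature.Probability.LatticeModels.prodBernoulli v₁).real
                  {ω : Literature.Probability.Percolation.BondConfig (Fin n) |
                    (A.filter fun z => ω ∈ Literature.Probability.Percolation.openConn b z).card ≤ j} -
              (Literature.Probability.LatticeModels.prodBernoulli v₂).real
                {ω : Literature.Probability.Percolation.BondConfig (Fin n) |
                  1 ≤ (A.filter fun z => ω ∈ Literature.Probability.Percolation.openConn o z).card ∧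
                  (A.filter fun z => ω ∈ Literature.Probability.Percolation.openConn o z).card ≤ j})) :
    Summit.CriticalPhenomena.PercolationContinuityZ3.Theses.PercNearOneGluing.NoHeavyLowerTail := by
  apply PatternLightest.noHeavyLowerTail_of_patternLightest
  intro n w A o j hoA
  obtain ⟨r, hr, hS⟩ := h n w A o j hoA
  exact patternLightest_stub_of_cornerPairs w A o j r hr hS

/-- **Typed target (tie-break form): free-edge peeling for SOME injective `H`-compatible ranking ⇒ `NoHeavyLowerTail`.**  If for every
weighted graph `w`, relays `A`, observer `o ∉ A` and level `j` there is a ranking `r`, injective on `A` and compatible with lightness in `H`,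
such that `(1 − w' s(o,y))·Φ_r(w'[s(o,y)↦0]) ≤ Φ_r(w')` for every `w'` agreeing with `w` off the pairs at `o` and every non-relay `y ≠ o` with
`w' s(o,y) ≠ 0`, then the crux holds. [folklore — reduction only; `patternLightest_of_freePeel`] -/
theorem noHeavyLowerTail_of_freePeel_exists
    (h : ∀ (n : ℕ) (w : Sym2 (Fin n) → unitInterval) (A : Finset (Fin n)) (o : Fin n) (j : ℕ), o ∉ A →
      ∃ r : Fin n → ℕ, Set.InjOn r ↑A ∧
        (∀ b ∈ A, ∀ b' ∈ A, r b < r b' →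
          (Literature.Probability.LatticeModels.prodBernoulli fun e : Sym2 (Fin n) =>
              if e ∈ {e : Sym2 (Fin n) | o ∉ e} then w e else 0).real
              {ω : Literature.Probability.Percolation.BondConfig (Fin n) |
                (A.filter fun z => ω ∈ Literature.Probability.Percolation.openConn b' z).card ≤ j} ≤
            (Literature.Probability.LatticeModels.prodBernoulli fun e : Sym2 (Fin n) =>
              if e ∈ {e : Sym2 (Fin n) | o ∉ e} then w e else 0).real
              {ω : Literature.Probability.Percolation.BondConfig (Fin n) |
                (A.filter fun z => ω ∈ Literature.Probability.Percolation.openConn b z).card ≤ j}) ∧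
        ∀ (w' : Sym2 (Fin n) → unitInterval) (y : Fin n), (∀ e : Sym2 (Fin n), o ∉ e → w' e = w e) →
          y ≠ o → y ∉ A → w' s(o, y) ≠ 0 →
          (1 - (w' s(o, y) : ℝ)) *
              (∑ b ∈ A, (Literature.Probability.LatticeModels.prodBernoulli (Function.update w' s(o, y) 0)).real
                  {ω : Literature.Probability.Percolation.BondConfig (Fin n) |
                    b ∈ (A.filter fun b' => ω ∈ Literature.Probability.Percolation.openConnIn ((↑A : Set (Fin n))ᶜ ∪ {b'}) o b') ∧
                    ∀ b' ∈ A, r b' < r b →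
                      b' ∉ (A.filter fun b'' => ω ∈ Literature.Probability.Percolation.openConnIn ((↑A : Set (Fin n))ᶜ ∪ {b''}) o b'')} *
                (Literature.Probability.LatticeModels.prodBernoulli (Function.update w' s(o, y) 0)).real
                  {ω : Literature.Probability.Percolation.BondConfig (Fin n) |
                    (A.filter fun z => ω ∈ Literature.Probability.Percolation.openConn b z).card ≤ j} -
              (Literature.Probability.LatticeModels.prodBernoulli (Function.update w' s(o, y) 0)).real
                {ω : Literature.Probability.Percolation.BondConfig (Fin n) |
                  1 ≤ (A.filter fun z => ω ∈ Literature.Probability.Percolation.openConn o z).card ∧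
                  (A.filter fun z => ω ∈ Literature.Probability.Percolation.openConn o z).card ≤ j}) ≤
            ∑ b ∈ A, (Literature.Probability.LatticeModels.prodBernoulli w').real
                {ω : Literature.Probability.Percolation.BondConfig (Fin n) |
                  b ∈ (A.filter fun b' => ω ∈ Literature.Probability.Percolation.openConnIn ((↑A : Set (Fin n))ᶜ ∪ {b'}) o b') ∧
                  ∀ b' ∈ A, r b' < r b →
                    b' ∉ (A.filter fun b'' => ω ∈ Literature.Probability.Percolation.openConnIn ((↑A : Set (Fin n))ᶜ ∪ {b''}) o b'')} *
              (Literature.Probability.LatticeModels.prodBernoulli w').real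
                {ω : Literature.Probability.Percolation.BondConfig (Fin n) |
                  (A.filter fun z => ω ∈ Literature.Probability.Percolation.openConn b z).card ≤ j} -
            (Literature.Probability.LatticeModels.prodBernoulli w').real
              {ω : Literature.Probability.Percolation.BondConfig (Fin n) |
                1 ≤ (A.filter fun z => ω ∈ Literature.Probability.Percolation.openConn o z).card ∧
                (A.filter fun z => ω ∈ Literature.Probability.Percolation.openConn o z).card ≤ j}) :
    Summit.CriticalPhenomena.PercolationContinuityZ3.Theses.PercNearOneGluing.NoHeavyLowerTail := by
  apply PatternLightest.noHeavyLowerTail_of_patternLightest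
  intro n w A o j hoA
  obtain ⟨r, hr, hcompat, hFP⟩ := h n w A o j hoA
  have hex : ∀ B : Finset (Fin n), B.Nonempty → ∃ b ∈ B, ∀ b' ∈ B, r b ≤ r b' :=
    fun B hB => Finset.exists_min_image B r hB
  set sel : Finset (Fin n) → Fin n := fun B => if h : B.Nonempty then Classical.choose (hex B h) else o with hseldef
  have hsel : ∀ B : Finset (Fin n), B.Nonempty → sel B ∈ B ∧ ∀ b ∈ B, r (sel B) ≤ r b := by
    intro B hB
    have h := Classical.choose_spec (hex B hB)
    simp only [hseldef, dif_pos hB]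
    exact ⟨h.1, h.2⟩
  refine ⟨sel, fun B hB => (hsel B (Finset.nonempty_iff_ne_empty.2 (Finset.ne_of_mem_erase hB))).1, ?_⟩
  have key := sum_sel_eq_sum_patterns (prodBernoulli w) A o r hr sel hsel
    (fun b => (prodBernoulli w).real {ω : BondConfig (Fin n) | (A.filter fun x => ω ∈ openConn b x).card ≤ j})
  rw [← key]
  exact patternLightest_of_freePeel w A j o r hr hoA hcompat hFP

/-- **Typed target (tie-break form): glue-step `(B*)` and positivity for deterministic observers, for SOME injective `H`-compatible
ranking ⇒ `NoHeavyLowerTail`.**  The hypothesis of `noHeavyLowerTail_of_glueStep_of_glued` with `∃ r` per `(w, A, o, j)` instead of `∀ r`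
(the glue-step `(B*)` is known to fail for some tie-breaks on the total-tie locus of `S^H`, never for all of them in the census).
[folklore — reduction only; `patternLightest_of_glueStep_of_glued`] -/
theorem noHeavyLowerTail_of_glueStep_exists
    (h : ∀ (n : ℕ) (w : Sym2 (Fin n) → unitInterval) (A : Finset (Fin n)) (o : Fin n) (j : ℕ), o ∉ A →
      ∃ r : Fin n → ℕ, Set.InjOn r ↑A ∧
        (∀ b ∈ A, ∀ b' ∈ A, r b < r b' →
          (Literature.Probability.LatticeModels.prodBernoulli fun e : Sym2 (Fin n) =>
              if e ∈ {e : Sym2 (Fin n) | o ∉ e} then w e else 0).real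
              {ω : Literature.Probability.Percolation.BondConfig (Fin n) |
                (A.filter fun z => ω ∈ Literature.Probability.Percolation.openConn b' z).card ≤ j} ≤
            (Literature.Probability.LatticeModels.prodBernoulli fun e : Sym2 (Fin n) =>
              if e ∈ {e : Sym2 (Fin n) | o ∉ e} then w e else 0).real
              {ω : Literature.Probability.Percolation.BondConfig (Fin n) |
                (A.filter fun z => ω ∈ Literature.Probability.Percolation.openConn b z).card ≤ j}) ∧
        (∀ (w' : Sym2 (Fin n) → unitInterval) (y : Fin n), (∀ e : Sym2 (Fin n), o ∉ e → w' e = w e) →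
          y ≠ o → y ∉ A → w' s(o, y) = 0 →
          ∑ b ∈ A, (Literature.Probability.LatticeModels.prodBernoulli w').real
                {ω : Literature.Probability.Percolation.BondConfig (Fin n) |
                  b ∈ (A.filter fun b' => ω ∈ Literature.Probability.Percolation.openConnIn ((↑A : Set (Fin n))ᶜ ∪ {b'}) o b') ∧
                  ∀ b' ∈ A, r b' < r b →
                    b' ∉ (A.filter fun b'' => ω ∈ Literature.Probability.Percolation.openConnIn ((↑A : Set (Fin n))ᶜ ∪ {b''}) o b'')} *
              ((Literature.Probability.LatticeModels.prodBernoulli w').real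
                  {ω : Literature.Probability.Percolation.BondConfig (Fin n) |
                    (A.filter fun z => ω ∈ Literature.Probability.Percolation.openConn b z).card ≤ j} -
                (Literature.Probability.LatticeModels.prodBernoulli (Function.update w' s(o, y) 1)).real
                  {ω : Literature.Probability.Percolation.BondConfig (Fin n) |
                    (A.filter fun z => ω ∈ Literature.Probability.Percolation.openConn b z).card ≤ j}) ≤
            ∑ b ∈ A, (Literature.Probability.LatticeModels.prodBernoulli (Function.update w' s(o, y) 1)).real
                {ω : Literature.Probability.Percolation.BondConfig (Fin n) |
                  b ∈ (A.filter fun b' => ω ∈ Literature.Probability.Percolation.openConnIn ((↑A : Set (Fin n))ᶜ ∪ {b'}) o b') ∧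
                  ∀ b' ∈ A, r b' < r b →
                    b' ∉ (A.filter fun b'' => ω ∈ Literature.Probability.Percolation.openConnIn ((↑A : Set (Fin n))ᶜ ∪ {b''}) o b'')} *
              (Literature.Probability.LatticeModels.prodBernoulli w').real
                {ω : Literature.Probability.Percolation.BondConfig (Fin n) |
                  (A.filter fun z => ω ∈ Literature.Probability.Percolation.openConn b z).card ≤ j} -
            (Literature.Probability.LatticeModels.prodBernoulli (Function.update w' s(o, y) 1)).real
              {ω : Literature.Probability.Percolation.BondConfig (Fin n) |
                1 ≤ (A.filter fun z => ω ∈ Literature.Probability.Percolation.openConn o z).card ∧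
                (A.filter fun z => ω ∈ Literature.Probability.Percolation.openConn o z).card ≤ j}) ∧
        (∀ (w' : Sym2 (Fin n) → unitInterval), (∀ e : Sym2 (Fin n), o ∉ e → w' e = w e) →
          (∀ y : Fin n, y ≠ o → w' s(o, y) = 0 ∨ w' s(o, y) = 1) →
          (Literature.Probability.LatticeModels.prodBernoulli w').real
              {ω : Literature.Probability.Percolation.BondConfig (Fin n) |
                1 ≤ (A.filter fun z => ω ∈ Literature.Probability.Percolation.openConn o z).card ∧
                (A.filter fun z => ω ∈ Literature.Probability.Percolation.openConn o z).card ≤ j} ≤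
            ∑ b ∈ A, (Literature.Probability.LatticeModels.prodBernoulli w').real
                {ω : Literature.Probability.Percolation.BondConfig (Fin n) |
                  b ∈ (A.filter fun b' => ω ∈ Literature.Probability.Percolation.openConnIn ((↑A : Set (Fin n))ᶜ ∪ {b'}) o b') ∧
                  ∀ b' ∈ A, r b' < r b →
                    b' ∉ (A.filter fun b'' => ω ∈ Literature.Probability.Percolation.openConnIn ((↑A : Set (Fin n))ᶜ ∪ {b''}) o b'')} *
              (Literature.Probability.LatticeModels.prodBernoulli w').real
                {ω : Literature.Probability.Percolation.BondConfig (Fin n) |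
                  (A.filter fun z => ω ∈ Literature.Probability.Percolation.openConn b z).card ≤ j})) :
    Summit.CriticalPhenomena.PercolationContinuityZ3.Theses.PercNearOneGluing.NoHeavyLowerTail := by
  apply PatternLightest.noHeavyLowerTail_of_patternLightest
  intro n w A o j hoA
  obtain ⟨r, hr, hcompat, hGS, hGL⟩ := h n w A o j hoA
  have hex : ∀ B : Finset (Fin n), B.Nonempty → ∃ b ∈ B, ∀ b' ∈ B, r b ≤ r b' :=
    fun B hB => Finset.exists_min_image B r hB
  set sel : Finset (Fin n) → Fin n := fun B => if h : B.Nonempty then Classical.choose (hex B h) else o with hseldef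
  have hsel : ∀ B : Finset (Fin n), B.Nonempty → sel B ∈ B ∧ ∀ b ∈ B, r (sel B) ≤ r b := by
    intro B hB
    have h := Classical.choose_spec (hex B hB)
    simp only [hseldef, dif_pos hB]
    exact ⟨h.1, h.2⟩
  refine ⟨sel, fun B hB => (hsel B (Finset.nonempty_iff_ne_empty.2 (Finset.ne_of_mem_erase hB))).1, ?_⟩
  have key := sum_sel_eq_sum_patterns (prodBernoulli w) A o r hr sel hsel
    (fun b => (prodBernoulli w).real {ω : BondConfig (Fin n) | (A.filter fun x => ω ∈ openConn b x).card ≤ j})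
  rw [← key]
  exact patternLightest_of_glueStep_of_glued w A j o r hr hoA hcompat hGS hGL

end CoinReduction

end Summit.CriticalPhenomena.PercolationContinuityZ3.Theorems

end
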